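import Mathlib.Data.Complex.Basic
import Mathlib.LinearAlgebra.Matrix.Permanent
import Literature.Computability.AlgebraicComplexity.StandardFamilies
import HarnessLib

/-!
# Crux `ProjectionStability.OptStep` (stmt-ValiantsHypothesis-17835), line `Sketch` —
# registered stub `stub_eval_perm_perPoly` (H1)

**The permanent of a permutation matrix is `1`.** For a permutation `π` of `Fin m`, evaluating
the generic permanent `per_m = perPoly (Fin m) ℂ` at the `0/1` point `p ↦ [p.2 = π p.1]` (the
permutation matrix `P_π`, entry `(i, π i) = 1`) gives `1`.  In the proof of the lower bound K2 of
the line this is the invertible member `A(P_π)` (determinant `per_m(P_π) = 1`) of the pencil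
restricted to the support of `P_π`.

Proof: by the tree lemma `eval_perPoly` the value is the permanent of
`Matrix.of fun i j => if j = π i then 1 else 0`, which is the row-permuted identity
`(1 : Matrix (Fin m) (Fin m) ℂ).submatrix π id`; permuting rows does not change the permanent
(`Matrix.permanent_permute_cols`, whose `submatrix σ id` permutes rows in this orientation) and
`Matrix.permanent_one`.

* `of_ite_eq_perm_eq_submatrix_one` — the `0/1` matrix of `π` is `1.submatrix π id`.
* `permanent_of_ite_eq_perm` — its permanent is `1`.
* `stub_eval_perm_perPoly` — the registered signature.

Unconditional (no named facts); Mathlib: `Matrix.permanent_permute_cols`, `Matrix.permanent_one`,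
`Matrix.one_apply`; tree: `Literature.Computability.AlgebraicComplexity.eval_perPoly`.
-/

-- layout Summits/ValiantsHypothesis/ValiantsHypothesis forces the duplicated namespace component
set_option linter.dupNamespace false

noncomputable section

namespace Summit.ValiantsHypothesis.ValiantsHypothesis.Theorems.ProjectionStabilityOptStep.EvalPermPerPoly

open MvPolynomial Literature.Computability.AlgebraicComplexity

/-- The `0/1` matrix of a permutation `π` (entry `(i, j)` equal to `1` iff `j = π i`) is the
identity matrix with its rows permuted by `π`, i.e. `(1 : Matrix n n R).submatrix π id`. [folklore] -/
theorem of_ite_eq_perm_eq_submatrix_one {n : Type*} [DecidableEq n] {R : Type*} [Zero R] [One R]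
    (π : Equiv.Perm n) :
    (Matrix.of fun i j : n => if j = π i then (1 : R) else 0) =
      (1 : Matrix n n R).submatrix π id := by
  ext i j
  simp only [Matrix.of_apply, Matrix.submatrix_apply, id_eq, Matrix.one_apply, eq_comm]

/-- The permanent of the `0/1` matrix of a permutation `π` is `1`
(`Matrix.permanent_permute_cols` and `Matrix.permanent_one`). [folklore] -/
theorem permanent_of_ite_eq_perm {n : Type*} [DecidableEq n] [Fintype n] {R : Type*}
    [CommSemiring R] (π : Equiv.Perm n) :
    (Matrix.of fun i j : n => if j = π i then (1 : R) else 0).permanent = 1 := by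
  rw [of_ite_eq_perm_eq_submatrix_one, Matrix.permanent_permute_cols, Matrix.permanent_one]

/-- **H1 — the permanent of a permutation matrix is `1`**: evaluating `per_m` at the `0/1` matrix
of `π` gives `1` (the invertible member `A(P_π)` of the `π`-restricted pencil in K2's proof):
`eval_perPoly` turns the evaluation into the permanent of the row-permuted identity matrix, which
is `1` by `permanent_of_ite_eq_perm`. [folklore] -/
theorem stub_eval_perm_perPoly :
    ∀ (m : ℕ) (π : Equiv.Perm (Fin m)),
      MvPolynomial.eval (fun p : Fin m × Fin m => if p.2 = π p.1 then (1 : ℂ) else 0)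
        (perPoly (Fin m) ℂ) = 1 := by
  intro m π
  rw [eval_perPoly]
  exact permanent_of_ite_eq_perm π

end Summit.ValiantsHypothesis.ValiantsHypothesis.Theorems.ProjectionStabilityOptStep.EvalPermPerPoly

end
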